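import Mathlib
import HarnessLib
import Summits.QuantumFields.YangMills.Theorems.HypercubicLimit.Negative.ReflectedDensity
import Summits.QuantumFields.YangMills.Theorems.FradkinShenkerFlowFiniteSusceptibilityWeakCouplingRPCauchySchwarz
import Literature.MathematicalPhysics.AQFT.OSAxiomsSchwinger
import Literature.MathematicalPhysics.QuantumFieldTheory.OSData
import Literature.MathematicalPhysics.QuantumLattice.LatticeScalarField
import Literature.MathematicalPhysics.QuantumFieldTheory.LatticeGaugeStaticPotentialProofs
import Literature.Probability.LatticeModels.ThermodynamicLimit

/-!
# Block POL of line `conditional-mean-telescoping` (crux stmt-QuantumFields-8646): polarisation of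
the diagonal RP-spectral slab clustering

On the odd torus of side `2S+1` at coupling `β` (`μ = wilsonMeasure r.ρ β`) write, for real
functionals `Y, Y'` of the infinite lattice read through the periodic lift,
`Bₙ(Y, Y') = ∫ Y(lift ΘU) · Y'(τₙ lift U) dμ − (∫ Y∘lift dμ)(∫ Y'∘lift dμ)` (reflected copy of `Y`
against the copy of `Y'` translated by `n` lattice units up in time, `τₙ = configShift (-n e₀)`) and
`B₀(Y) = ∫ Y(lift ΘU) · Y(lift U) dμ − (∫ Y∘lift dμ)²`.  If EVERY bounded measurable slab functional
`Y` (`|Y| ≤ B`) satisfies the DIAGONAL bound `|Bₙ(Y, Y)| ≤ θ B₀(Y) + ε B²`, then every PAIR of such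
functionals with a common bound `B` satisfies `|Bₙ(Y, Y')| ≤ ½ θ (B₀(Y) + B₀(Y')) + 2 ε B²`.

Proof.  (1) Apply the hypothesis to `Y ± Y'` (bounded by `2B`, slab-dependent).  (2) Bilinearity
(all pairings are integrals of products of bounded measurable functions on a probability space):
`Bₙ(Y+Y', Y+Y') − Bₙ(Y−Y', Y−Y') = 2 Bₙ(Y, Y') + 2 Bₙ(Y', Y)` and
`B₀(Y+Y') + B₀(Y−Y') = 2 B₀(Y) + 2 B₀(Y')`.  (3) Symmetry `Bₙ(Y', Y) = Bₙ(Y, Y')`: substitute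
`U ↦ ΘU` (`Θ` is a measure-preserving involution, `wilsonMeasure_map_timeReflect`), use
`τₙ ∘ lift ∘ Θ = lift ∘ Θ ∘ σ` and `τₙ ∘ lift = lift ∘ σ⁻¹` for the torus time translation
`σ = torusConfigShift (n ē₀)` (the reflection conjugates a time translation to its inverse), and the
translation invariance `wilsonMeasure_map_torusConfigShift`.  (4) Add the two instances of the
hypothesis (triangle inequality; no sign condition on `θ` is needed) and divide by `4`. [folklore]
-/

noncomputable section

open scoped SchwartzMap ComplexConjugate
open MeasureTheory Filter Topology
open Literature.MathematicalPhysics.AQFT Literature.MathematicalPhysics.QuantumLattice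
open Literature.MathematicalPhysics.QuantumFieldTheory
open Literature.Probability.LatticeModels (box Site)
open Summit.QuantumFields.YangMills.Theorems.HypercubicLimit.Negative (torusPlaquette thetaZ)

namespace Summit.QuantumFields.YangMills.Cruxes.HypercubicLimit.ConditionalMeanTelescoping

/-! ### Abstract part: bounded functionals read through measurable maps -/

/-- (auxiliary, block POL) A bounded measurable functional read through a measurable map is
integrable for a finite measure. [folklore] -/
theorem pol_integrable {Ω X : Type*} [MeasurableSpace Ω] [MeasurableSpace X] {μ : Measure Ω}
    [IsFiniteMeasure μ] {p : Ω → X} (hp : Measurable p) {F : X → ℝ} (hF : Measurable F) {C : ℝ}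
    (hC : ∀ x, |F x| ≤ C) : Integrable (fun ω => F (p ω)) μ :=
  Integrable.of_bound (hF.comp hp).aestronglyMeasurable C
    (ae_of_all _ fun ω => by rw [Real.norm_eq_abs]; exact hC _)

/-- (auxiliary, block POL) Products of bounded measurable functionals read through measurable maps
are integrable for a finite measure. [folklore] -/
theorem pol_integrable_mul {Ω X : Type*} [MeasurableSpace Ω] [MeasurableSpace X] {μ : Measure Ω}
    [IsFiniteMeasure μ] {p q : Ω → X} (hp : Measurable p) (hq : Measurable q) {F K : X → ℝ}
    (hF : Measurable F) (hK : Measurable K) {CF CK : ℝ} (hCF : ∀ x, |F x| ≤ CF)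
    (hCK : ∀ x, |K x| ≤ CK) : Integrable (fun ω => F (p ω) * K (q ω)) μ := by
  refine Integrable.of_bound ((hF.comp hp).mul (hK.comp hq)).aestronglyMeasurable (CF * CK)
    (ae_of_all _ fun ω => ?_)
  rw [Real.norm_eq_abs, abs_mul]
  exact mul_le_mul (hCF _) (hCK _) (abs_nonneg _) ((abs_nonneg _).trans (hCF (p ω)))

/-- (auxiliary, block POL) Bilinear expansion of `∫ (F+K)(p ω) · (F+K)(q ω) dμ`. [folklore] -/
theorem pol_integral_add_mul_add {Ω X : Type*} [MeasurableSpace Ω] [MeasurableSpace X]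
    {μ : Measure Ω} [IsFiniteMeasure μ] {p q : Ω → X} (hp : Measurable p) (hq : Measurable q)
    {F K : X → ℝ} (hF : Measurable F) (hK : Measurable K) {C : ℝ} (hCF : ∀ x, |F x| ≤ C)
    (hCK : ∀ x, |K x| ≤ C) :
    ∫ ω, (F (p ω) + K (p ω)) * (F (q ω) + K (q ω)) ∂μ =
      (∫ ω, F (p ω) * F (q ω) ∂μ + ∫ ω, F (p ω) * K (q ω) ∂μ) +
        (∫ ω, K (p ω) * F (q ω) ∂μ + ∫ ω, K (p ω) * K (q ω) ∂μ) := by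
  have iFF := pol_integrable_mul (μ := μ) hp hq hF hF hCF hCF
  have iFK := pol_integrable_mul (μ := μ) hp hq hF hK hCF hCK
  have iKF := pol_integrable_mul (μ := μ) hp hq hK hF hCK hCF
  have iKK := pol_integrable_mul (μ := μ) hp hq hK hK hCK hCK
  have iA : Integrable (fun ω => F (p ω) * F (q ω) + F (p ω) * K (q ω)) μ := iFF.add iFK
  have iB : Integrable (fun ω => K (p ω) * F (q ω) + K (p ω) * K (q ω)) μ := iKF.add iKK
  have e : ∀ ω, (F (p ω) + K (p ω)) * (F (q ω) + K (q ω)) =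
      (F (p ω) * F (q ω) + F (p ω) * K (q ω)) + (K (p ω) * F (q ω) + K (p ω) * K (q ω)) :=
    fun ω => by ring
  simp_rw [e]
  rw [integral_add iA iB, integral_add iFF iFK, integral_add iKF iKK]

/-- (auxiliary, block POL) Bilinear expansion of `∫ (F−K)(p ω) · (F−K)(q ω) dμ`. [folklore] -/
theorem pol_integral_sub_mul_sub {Ω X : Type*} [MeasurableSpace Ω] [MeasurableSpace X]
    {μ : Measure Ω} [IsFiniteMeasure μ] {p q : Ω → X} (hp : Measurable p) (hq : Measurable q)
    {F K : X → ℝ} (hF : Measurable F) (hK : Measurable K) {C : ℝ} (hCF : ∀ x, |F x| ≤ C)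
    (hCK : ∀ x, |K x| ≤ C) :
    ∫ ω, (F (p ω) - K (p ω)) * (F (q ω) - K (q ω)) ∂μ =
      (∫ ω, F (p ω) * F (q ω) ∂μ - ∫ ω, F (p ω) * K (q ω) ∂μ) -
        (∫ ω, K (p ω) * F (q ω) ∂μ - ∫ ω, K (p ω) * K (q ω) ∂μ) := by
  have iFF := pol_integrable_mul (μ := μ) hp hq hF hF hCF hCF
  have iFK := pol_integrable_mul (μ := μ) hp hq hF hK hCF hCK
  have iKF := pol_integrable_mul (μ := μ) hp hq hK hF hCK hCF
  have iKK := pol_integrable_mul (μ := μ) hp hq hK hK hCK hCK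
  have iA : Integrable (fun ω => F (p ω) * F (q ω) - F (p ω) * K (q ω)) μ := iFF.sub iFK
  have iB : Integrable (fun ω => K (p ω) * F (q ω) - K (p ω) * K (q ω)) μ := iKF.sub iKK
  have e : ∀ ω, (F (p ω) - K (p ω)) * (F (q ω) - K (q ω)) =
      (F (p ω) * F (q ω) - F (p ω) * K (q ω)) - (K (p ω) * F (q ω) - K (p ω) * K (q ω)) :=
    fun ω => by ring
  simp_rw [e]
  rw [integral_sub iA iB, integral_sub iFF iFK, integral_sub iKF iKK]

/-- (auxiliary, block POL) The real-arithmetic heart of the polarisation: the two diagonal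
instances for `Y + Y'` and `Y − Y'` (with `⟨ΘY'·τY⟩` already replaced by `⟨ΘY·τY'⟩`) give the
off-diagonal bound after dividing by `4`. [folklore] -/
theorem pol_arith {i₁ i₂ i₄ j₁ j₂ j₃ j₄ m₁ m₂ θ ε C : ℝ}
    (h4 : |i₁ + i₂ + (i₂ + i₄) - (m₁ + m₂) ^ 2| ≤
      θ * (j₁ + j₂ + (j₃ + j₄) - (m₁ + m₂) ^ 2) + ε * (2 * C) ^ 2)
    (h5 : |i₁ - i₂ - (i₂ - i₄) - (m₁ - m₂) ^ 2| ≤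
      θ * (j₁ - j₂ - (j₃ - j₄) - (m₁ - m₂) ^ 2) + ε * (2 * C) ^ 2) :
    |i₂ - m₁ * m₂| ≤ θ * 2⁻¹ * (j₁ - m₁ ^ 2 + (j₄ - m₂ ^ 2)) + 2 * ε * C ^ 2 := by
  have key : |i₁ + i₂ + (i₂ + i₄) - (m₁ + m₂) ^ 2 - (i₁ - i₂ - (i₂ - i₄) - (m₁ - m₂) ^ 2)| ≤
      θ * (j₁ + j₂ + (j₃ + j₄) - (m₁ + m₂) ^ 2) + ε * (2 * C) ^ 2 +
        (θ * (j₁ - j₂ - (j₃ - j₄) - (m₁ - m₂) ^ 2) + ε * (2 * C) ^ 2) :=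
    (abs_sub _ _).trans (add_le_add h4 h5)
  have hA : i₁ + i₂ + (i₂ + i₄) - (m₁ + m₂) ^ 2 - (i₁ - i₂ - (i₂ - i₄) - (m₁ - m₂) ^ 2) =
      4 * (i₂ - m₁ * m₂) := by ring
  have hR : θ * (j₁ + j₂ + (j₃ + j₄) - (m₁ + m₂) ^ 2) + ε * (2 * C) ^ 2 +
        (θ * (j₁ - j₂ - (j₃ - j₄) - (m₁ - m₂) ^ 2) + ε * (2 * C) ^ 2) =
      4 * (θ * 2⁻¹ * (j₁ - m₁ ^ 2 + (j₄ - m₂ ^ 2)) + 2 * ε * C ^ 2) := by ring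
  rw [hA, hR, abs_mul, abs_of_pos (by norm_num : (0 : ℝ) < 4)] at key
  exact le_of_mul_le_mul_left key (by norm_num)

/-- (auxiliary, block POL) **Abstract polarisation.** For a finite measure `μ`, measurable maps
`ta, tb, tc : Ω → X` and a class `D` of functionals closed under sums and differences: if every
measurable `F ∈ D` with `|F| ≤ C` satisfies
`|∫ F(ta)F(tb) − (∫ F(tc))²| ≤ θ (∫ F(ta)F(tc) − (∫ F(tc))²) + ε C²`, then for `F, K ∈ D` with a
common bound `C` and the symmetry `∫ K(ta)F(tb) = ∫ F(ta)K(tb)` one has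
`|∫ F(ta)K(tb) − (∫ F(tc))(∫ K(tc))| ≤ ½ θ (B₀(F) + B₀(K)) + 2 ε C²`. [folklore] -/
theorem pol_abstract {Ω X : Type*} [MeasurableSpace Ω] [MeasurableSpace X] {μ : Measure Ω}
    [IsFiniteMeasure μ] {ta tb tc : Ω → X} (hta : Measurable ta) (htb : Measurable tb)
    (htc : Measurable tc) {D : (X → ℝ) → Prop}
    (hDadd : ∀ F K : X → ℝ, D F → D K → D fun x => F x + K x)
    (hDsub : ∀ F K : X → ℝ, D F → D K → D fun x => F x - K x) {θ ε : ℝ}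
    (hyp : ∀ (F : X → ℝ) (C : ℝ), Measurable F → (∀ x, |F x| ≤ C) → D F →
      |(∫ ω, F (ta ω) * F (tb ω) ∂μ) - (∫ ω, F (tc ω) ∂μ) ^ 2| ≤
        θ * ((∫ ω, F (ta ω) * F (tc ω) ∂μ) - (∫ ω, F (tc ω) ∂μ) ^ 2) + ε * C ^ 2)
    {F K : X → ℝ} {C : ℝ} (hF : Measurable F) (hK : Measurable K) (hCF : ∀ x, |F x| ≤ C)
    (hCK : ∀ x, |K x| ≤ C) (hDF : D F) (hDK : D K)
    (hsym : ∫ ω, K (ta ω) * F (tb ω) ∂μ = ∫ ω, F (ta ω) * K (tb ω) ∂μ) :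
    |(∫ ω, F (ta ω) * K (tb ω) ∂μ) - (∫ ω, F (tc ω) ∂μ) * (∫ ω, K (tc ω) ∂μ)| ≤
      θ * 2⁻¹ * (((∫ ω, F (ta ω) * F (tc ω) ∂μ) - (∫ ω, F (tc ω) ∂μ) ^ 2) +
        ((∫ ω, K (ta ω) * K (tc ω) ∂μ) - (∫ ω, K (tc ω) ∂μ) ^ 2)) + 2 * ε * C ^ 2 := by
  have hCu : ∀ x, |F x + K x| ≤ 2 * C := fun x =>
    (abs_add_le _ _).trans (by linarith [hCF x, hCK x])
  have hCw : ∀ x, |F x - K x| ≤ 2 * C := fun x =>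
    (abs_sub _ _).trans (by linarith [hCF x, hCK x])
  have h4 := hyp (fun x => F x + K x) (2 * C) (hF.add hK) hCu (hDadd F K hDF hDK)
  have h5 := hyp (fun x => F x - K x) (2 * C) (hF.sub hK) hCw (hDsub F K hDF hDK)
  simp only [pol_integral_add_mul_add hta htb hF hK hCF hCK,
    pol_integral_add_mul_add hta htc hF hK hCF hCK,
    integral_add (pol_integrable htc hF hCF) (pol_integrable htc hK hCK)] at h4
  simp only [pol_integral_sub_mul_sub hta htb hF hK hCF hCK,
    pol_integral_sub_mul_sub hta htc hF hK hCF hCK,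
    integral_sub (pol_integrable htc hF hCF) (pol_integrable htc hK hCK)] at h5
  rw [hsym] at h4 h5
  exact pol_arith h4 h5

/-- (auxiliary, block POL) **Abstract symmetry of the reflected–translated pairing.** If `Θ` is a
measure-preserving measurable involution, `τ` is measure preserving with left inverse `τ'`, and the
read-out maps satisfy `s ∘ ℓ ∘ Θ = ℓ ∘ Θ ∘ τ` and `s ∘ ℓ = ℓ ∘ τ'`, then
`∫ K(ℓ Θω) F(s ℓ ω) dμ = ∫ F(ℓ Θω) K(s ℓ ω) dμ` for measurable `F, K`. [folklore] -/
theorem pol_symm_abstract {Ω X : Type*} [MeasurableSpace Ω] [MeasurableSpace X] {μ : Measure Ω}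
    {Θ τ τ' : Ω → Ω} {ℓ : Ω → X} {s : X → X}
    (hΘm : Measurable Θ) (hΘμ : μ.map Θ = μ) (hΘΘ : ∀ ω, Θ (Θ ω) = ω)
    (hτm : Measurable τ) (hτμ : μ.map τ = μ) (hτ'm : Measurable τ')
    (hττ' : ∀ ω, τ' (τ ω) = ω) (hℓ : Measurable ℓ) (hs : Measurable s)
    (h1 : ∀ ω, s (ℓ (Θ ω)) = ℓ (Θ (τ ω))) (h2 : ∀ ω, s (ℓ ω) = ℓ (τ' ω))
    {F K : X → ℝ} (hF : Measurable F) (hK : Measurable K) :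
    ∫ ω, K (ℓ (Θ ω)) * F (s (ℓ ω)) ∂μ = ∫ ω, F (ℓ (Θ ω)) * K (s (ℓ ω)) ∂μ := by
  have hm1 : Measurable fun ω => K (ℓ (Θ ω)) * F (s (ℓ ω)) :=
    (hK.comp (hℓ.comp hΘm)).mul (hF.comp (hs.comp hℓ))
  have hm2 : Measurable fun ω => K (ℓ (τ' ω)) * F (ℓ (Θ ω)) :=
    (hK.comp (hℓ.comp hτ'm)).mul (hF.comp (hℓ.comp hΘm))
  calc ∫ ω, K (ℓ (Θ ω)) * F (s (ℓ ω)) ∂μ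
      = ∫ ω, K (ℓ (Θ (Θ ω))) * F (s (ℓ (Θ ω))) ∂μ :=
        (Summit.QuantumFields.YangMills.Theorems.FiniteSusceptibilityWeakCoupling.RPCauchySchwarz.integral_comp_eq
          hΘm hΘμ hm1).symm
    _ = ∫ ω, K (ℓ (τ' (τ ω))) * F (ℓ (Θ (τ ω))) ∂μ := by
        congr 1
        funext ω
        rw [hΘΘ, h1, hττ']
    _ = ∫ ω, K (ℓ (τ' ω)) * F (ℓ (Θ ω)) ∂μ :=
        Summit.QuantumFields.YangMills.Theorems.FiniteSusceptibilityWeakCoupling.RPCauchySchwarz.integral_comp_eq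
          hτm hτμ hm2
    _ = ∫ ω, F (ℓ (Θ ω)) * K (s (ℓ ω)) ∂μ := by
        congr 1
        funext ω
        rw [h2, mul_comm]

/-- (auxiliary, block POL) `DependsOn` is closed under pointwise sums. [folklore] -/
theorem pol_dependsOn_add {ι M : Type*} {s : Set ι} {F K : (ι → M) → ℝ} (hF : DependsOn F s)
    (hK : DependsOn K s) : DependsOn (fun U => F U + K U) s := fun U V hUV => by
  show F U + K U = F V + K V
  rw [hF hUV, hK hUV]

/-- (auxiliary, block POL) `DependsOn` is closed under pointwise differences. [folklore] -/
theorem pol_dependsOn_sub {ι M : Type*} {s : Set ι} {F K : (ι → M) → ℝ} (hF : DependsOn F s)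
    (hK : DependsOn K s) : DependsOn (fun U => F U - K U) s := fun U V hUV => by
  show F U - K U = F V - K V
  rw [hF hUV, hK hUV]

/-! ### Lattice part: the reflection conjugates a time translation to its inverse -/

/-- (auxiliary, block POL) Projection to the torus of a temporal translate: `proj (x + c e₀) =
proj x + c ē₀`. [folklore] -/
theorem pol_proj_sub_neg_single (L : ℕ) (c : ℤ) (x : Fin 4 → ℤ) :
    Literature.Probability.LatticeModels.Torus.proj L (x - -Pi.single 0 c) =
      Literature.Probability.LatticeModels.Torus.proj L x - -Pi.single 0 (c : ZMod L) := by
  funext k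
  by_cases hk : k = 0
  · subst hk
    simp [Literature.Probability.LatticeModels.Torus.proj_apply]
  · simp [Literature.Probability.LatticeModels.Torus.proj_apply, hk]

/-- (auxiliary, block POL) The torus time reflection `t ↦ 1 − t` conjugates the time translation by
`c` to the one by `−c`: `θ(proj (x + c e₀)) = θ(proj x) − c ē₀`. [folklore] -/
theorem pol_timeReflect_proj (L : ℕ) (c : ℤ) (x : Fin 4 → ℤ) :
    Literature.MathematicalPhysics.QuantumFieldTheory.Site.timeReflect
        (Literature.Probability.LatticeModels.Torus.proj L (x - -Pi.single 0 c)) =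
      Literature.MathematicalPhysics.QuantumFieldTheory.Site.timeReflect
          (Literature.Probability.LatticeModels.Torus.proj L x) - Pi.single 0 (c : ZMod L) := by
  funext k
  by_cases hk : k = 0
  · subst hk
    simp only [Literature.MathematicalPhysics.QuantumFieldTheory.Site.timeReflect,
      Function.update_self, Literature.Probability.LatticeModels.Torus.proj_apply, Pi.sub_apply,
      Pi.neg_apply, Pi.single_eq_same, Int.cast_sub, Int.cast_neg]
    ring
  · simp [Literature.MathematicalPhysics.QuantumFieldTheory.Site.timeReflect,
      Literature.Probability.LatticeModels.Torus.proj_apply, hk]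

/-- (auxiliary, block POL) The same conjugation for the shifted base point of a temporal link:
`θ(proj (x + c e₀) + ē₀) = θ(proj x + ē₀) − c ē₀`. [folklore] -/
theorem pol_timeReflect_shift_proj (L : ℕ) (c : ℤ) (x : Fin 4 → ℤ) :
    Literature.MathematicalPhysics.QuantumFieldTheory.Site.timeReflect
        (Literature.MathematicalPhysics.QuantumFieldTheory.Site.shift
          (Literature.Probability.LatticeModels.Torus.proj L (x - -Pi.single 0 c)) 0) =
      Literature.MathematicalPhysics.QuantumFieldTheory.Site.timeReflect
          (Literature.MathematicalPhysics.QuantumFieldTheory.Site.shift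
            (Literature.Probability.LatticeModels.Torus.proj L x) 0) - Pi.single 0 (c : ZMod L) := by
  funext k
  by_cases hk : k = 0
  · subst hk
    simp only [Literature.MathematicalPhysics.QuantumFieldTheory.Site.timeReflect,
      Literature.MathematicalPhysics.QuantumFieldTheory.Site.shift,
      Function.update_self, Literature.Probability.LatticeModels.Torus.proj_apply, Pi.add_apply,
      Pi.sub_apply, Pi.neg_apply, Pi.single_eq_same, Int.cast_sub, Int.cast_neg]
    ring
  · simp [Literature.MathematicalPhysics.QuantumFieldTheory.Site.timeReflect,
      Literature.MathematicalPhysics.QuantumFieldTheory.Site.shift,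
      Literature.Probability.LatticeModels.Torus.proj_apply, hk]

/-- (auxiliary, block POL) The periodic lift intertwines the time translations of `ℤ⁴` and of the
torus: `τ_{-c e₀} ∘ lift = lift ∘ σ_{-c ē₀}`. [folklore] -/
theorem pol_shift_lift {G : Type*} [MeasurableSpace G] (L : ℕ) (c : ℤ) (V : GaugeConfig 4 L G) :
    configShift (-Pi.single 0 c) (torusLift L V) =
      torusLift L (torusConfigShift (-Pi.single 0 (c : ZMod L)) V) := by
  funext ⟨x, i⟩
  simp only [configShift_apply, torusLift, Function.comp_apply, torusEdge, torusConfigShift_apply,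
    pol_proj_sub_neg_single]

/-- (auxiliary, block POL) **`Θ` conjugates a time translation to its inverse, through the lift**:
`τ_{-c e₀} ∘ lift ∘ Θ = lift ∘ Θ ∘ σ_{c ē₀}`. [folklore] -/
theorem pol_shift_lift_timeReflect {G : Type*} [Group G] [MeasurableSpace G] (L : ℕ) (c : ℤ)
    (V : GaugeConfig 4 L G) :
    configShift (-Pi.single 0 c) (torusLift L (GaugeConfig.timeReflect V)) =
      torusLift L (GaugeConfig.timeReflect (torusConfigShift (Pi.single 0 (c : ZMod L)) V)) := by
  funext ⟨x, i⟩
  by_cases hi : i = 0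
  · subst hi
    simp only [configShift_apply, torusLift, Function.comp_apply, torusEdge,
      GaugeConfig.timeReflect, ↓reduceIte, torusConfigShift_apply, pol_timeReflect_shift_proj]
  · simp only [configShift_apply, torusLift, Function.comp_apply, torusEdge,
      GaugeConfig.timeReflect, hi, ↓reduceIte, torusConfigShift_apply, pol_timeReflect_proj]

/-- (auxiliary, block POL) **Symmetry of the reflected–translated slab pairing on the odd torus**:
`∫ Y'(lift ΘU) · Y(τₙ lift U) dμ = ∫ Y(lift ΘU) · Y'(τₙ lift U) dμ` for Wilson's torus measure
(`Θ`- and translation invariance, `Θ σₙ = σ₋ₙ Θ`). [folklore] -/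
theorem pol_symm {G : Type} [Group G] [TopologicalSpace G] [IsTopologicalGroup G] [CompactSpace G]
    [MeasurableSpace G] [BorelSpace G] (r : LatticeRep G) (β : ℝ) (S n : ℕ)
    {Y Y' : LGConfig 4 G → ℝ} (hY : Measurable Y) (hY' : Measurable Y') :
    ∫ U, Y' (torusLift (2 * S + 1) (GaugeConfig.timeReflect U)) *
        Y (configShift (-Pi.single 0 (n : ℤ)) (torusLift (2 * S + 1) U))
      ∂(wilsonMeasure r.ρ β : Measure (GaugeConfig 4 (2 * S + 1) G)) =
    ∫ U, Y (torusLift (2 * S + 1) (GaugeConfig.timeReflect U)) *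
        Y' (configShift (-Pi.single 0 (n : ℤ)) (torusLift (2 * S + 1) U))
      ∂(wilsonMeasure r.ρ β : Measure (GaugeConfig 4 (2 * S + 1) G)) :=
  pol_symm_abstract (μ := (wilsonMeasure r.ρ β : Measure (GaugeConfig 4 (2 * S + 1) G)))
    (Θ := GaugeConfig.timeReflect)
    (τ := torusConfigShift (Pi.single 0 ((n : ℤ) : ZMod (2 * S + 1))))
    (τ' := torusConfigShift (-Pi.single 0 ((n : ℤ) : ZMod (2 * S + 1))))
    (ℓ := torusLift (2 * S + 1)) (s := configShift (-Pi.single 0 (n : ℤ)))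
    WilsonRP.measurable_timeReflect
    (Summit.QuantumFields.YangMills.Theorems.FiniteSusceptibilityWeakCoupling.RPCauchySchwarz.wilsonMeasure_map_timeReflect
      r.ρ r.continuous β)
    Summit.QuantumFields.YangMills.Theorems.FiniteSusceptibilityWeakCoupling.RPCauchySchwarz.timeReflect_timeReflect
    (torusConfigShift _).measurable (wilsonMeasure_map_torusConfigShift r.ρ β _)
    (torusConfigShift _).measurable
    (Summit.QuantumFields.YangMills.Theorems.FiniteSusceptibilityWeakCoupling.RPCauchySchwarz.torusConfigShift_neg_shift
      _)
    (measurable_torusLift _) (configShift _).measurable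
    (pol_shift_lift_timeReflect (2 * S + 1) n) (pol_shift_lift (2 * S + 1) n) hY hY'

/-- **Block POL (polarisation of the diagonal slab clustering).** On the odd torus of side `2S+1` at
coupling `β`, if EVERY bounded measurable real functional `Y` of the time slab `[1, T]` satisfies the
diagonal RP-spectral clustering inequality of `GapData` (iii) at separation `n` with rate factor `θ`
and slack `ε B²`, then every PAIR `Y, Y'` of such functionals (common bound `B`) satisfies the
off-diagonal bound `|⟨ΘY · τₙY'⟩ − ⟨Y⟩⟨Y'⟩| ≤ ½ θ (B₀(Y) + B₀(Y')) + 2 ε B²` (`B₀` the RP squares):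
apply the hypothesis to `Y ± Y'` and use bilinearity and the symmetry
`⟨ΘY · τₙY'⟩ = ⟨ΘY' · τₙY⟩` (Θ- and translation invariance of the torus state, `Θ τₙ = τ₋ₙ Θ`). -/
theorem rpBlock_polarisedClustering :
    ∀ (G : Type) [Group G] [TopologicalSpace G] [IsTopologicalGroup G] [CompactSpace G]
      [MeasurableSpace G] [BorelSpace G] (r : LatticeRep G) (β : ℝ) (S T n : ℕ) (θ ε : ℝ),
      (∀ (Y : LGConfig 4 G → ℝ) (B : ℝ), Measurable Y → (∀ U, |Y U| ≤ B) →
        DependsOn Y {e : Literature.MathematicalPhysics.QuantumLattice.ZdEdge 4 |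
          1 ≤ e.1 0 ∧ e.1 0 + (if e.2 = 0 then 1 else 0) ≤ T} →
          |(∫ U, Y (torusLift (2 * S + 1) (GaugeConfig.timeReflect U)) *
                Y (configShift (-Pi.single 0 (n : ℤ)) (torusLift (2 * S + 1) U))
              ∂(wilsonMeasure r.ρ β : Measure (GaugeConfig 4 (2 * S + 1) G))) -
            (∫ U, Y (torusLift (2 * S + 1) U)
              ∂(wilsonMeasure r.ρ β : Measure (GaugeConfig 4 (2 * S + 1) G))) ^ 2| ≤
            θ * ((∫ U, Y (torusLift (2 * S + 1) (GaugeConfig.timeReflect U)) * Y (torusLift (2 * S + 1) U)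
                    ∂(wilsonMeasure r.ρ β : Measure (GaugeConfig 4 (2 * S + 1) G))) -
                  (∫ U, Y (torusLift (2 * S + 1) U)
                    ∂(wilsonMeasure r.ρ β : Measure (GaugeConfig 4 (2 * S + 1) G))) ^ 2) +
              ε * B ^ 2) →
      ∀ (Y Y' : LGConfig 4 G → ℝ) (B : ℝ), Measurable Y → Measurable Y' →
        (∀ U, |Y U| ≤ B) → (∀ U, |Y' U| ≤ B) →
        DependsOn Y {e : Literature.MathematicalPhysics.QuantumLattice.ZdEdge 4 |
          1 ≤ e.1 0 ∧ e.1 0 + (if e.2 = 0 then 1 else 0) ≤ T} →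
        DependsOn Y' {e : Literature.MathematicalPhysics.QuantumLattice.ZdEdge 4 |
          1 ≤ e.1 0 ∧ e.1 0 + (if e.2 = 0 then 1 else 0) ≤ T} →
          |(∫ U, Y (torusLift (2 * S + 1) (GaugeConfig.timeReflect U)) *
                Y' (configShift (-Pi.single 0 (n : ℤ)) (torusLift (2 * S + 1) U))
              ∂(wilsonMeasure r.ρ β : Measure (GaugeConfig 4 (2 * S + 1) G))) -
            (∫ U, Y (torusLift (2 * S + 1) U)
                ∂(wilsonMeasure r.ρ β : Measure (GaugeConfig 4 (2 * S + 1) G))) *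
              (∫ U, Y' (torusLift (2 * S + 1) U)
                ∂(wilsonMeasure r.ρ β : Measure (GaugeConfig 4 (2 * S + 1) G)))| ≤
            θ * (2⁻¹ : ℝ) *
                (((∫ U, Y (torusLift (2 * S + 1) (GaugeConfig.timeReflect U)) * Y (torusLift (2 * S + 1) U)
                      ∂(wilsonMeasure r.ρ β : Measure (GaugeConfig 4 (2 * S + 1) G))) -
                    (∫ U, Y (torusLift (2 * S + 1) U)
                      ∂(wilsonMeasure r.ρ β : Measure (GaugeConfig 4 (2 * S + 1) G))) ^ 2) +
                  ((∫ U, Y' (torusLift (2 * S + 1) (GaugeConfig.timeReflect U)) * Y' (torusLift (2 * S + 1) U)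
                      ∂(wilsonMeasure r.ρ β : Measure (GaugeConfig 4 (2 * S + 1) G))) -
                    (∫ U, Y' (torusLift (2 * S + 1) U)
                      ∂(wilsonMeasure r.ρ β : Measure (GaugeConfig 4 (2 * S + 1) G))) ^ 2)) +
              2 * ε * B ^ 2 := by
  intro G _ _ _ _ _ _ r β S T n θ ε hdiag Y Y' B hY hY' hbY hbY' hDY hDY'
  haveI := isProbabilityMeasure_wilsonMeasure (d := 4) (L := 2 * S + 1) (G := G) r.ρ r.continuous β
  have hL : Measurable (torusLift (d := 4) (G := G) (2 * S + 1)) := measurable_torusLift _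
  have hΘm : Measurable
      (GaugeConfig.timeReflect : GaugeConfig 4 (2 * S + 1) G → GaugeConfig 4 (2 * S + 1) G) :=
    WilsonRP.measurable_timeReflect
  have hsh := (configShift (G := G) (-Pi.single 0 (n : ℤ) : Fin 4 → ℤ)).measurable
  exact pol_abstract (μ := (wilsonMeasure r.ρ β : Measure (GaugeConfig 4 (2 * S + 1) G)))
    (ta := fun U => torusLift (2 * S + 1) (GaugeConfig.timeReflect U))
    (tb := fun U => configShift (-Pi.single 0 (n : ℤ)) (torusLift (2 * S + 1) U))
    (tc := torusLift (2 * S + 1))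
    (D := fun Z : LGConfig 4 G → ℝ =>
      DependsOn Z {e : Literature.MathematicalPhysics.QuantumLattice.ZdEdge 4 |
        1 ≤ e.1 0 ∧ e.1 0 + (if e.2 = 0 then 1 else 0) ≤ T})
    (hL.comp hΘm) (hsh.comp hL) hL
    (fun F K hF hK => pol_dependsOn_add hF hK) (fun F K hF hK => pol_dependsOn_sub hF hK)
    hdiag hY hY' hbY hbY' hDY hDY' (pol_symm r β S n hY hY')

end Summit.QuantumFields.YangMills.Cruxes.HypercubicLimit.ConditionalMeanTelescoping

end
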